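import Summits.CriticalPhenomena.PercolationContinuityZ3.Theorems.PercNearOneGluingNoHeavyPcintKernSymZ6S5Check1
import HarnessLib

/-!
# PCINT lane: `p_c^site(ℤ⁶) ≥ 0.1001` (kernel-checked B2r window certificate, memory 5 (4-step windows, 20736 codes); the tree's previous kernel bound is the memory-4 closed form `1/((d-1)+√((d-1)²+1)) = 0.0990`; printed lower bound = the bond one).

Cell `prim-pcint`, seat `prim-pcint-2` (gen 2); memo `run/shared/lean/prim/pcint/INTERVAL-PLAN.md` §14.  Does NOT build on p205010.
Assembles the kernel-checked chunks (`…KernZ6S5Check1..1`) and applies the generic certificate theorem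
`WinK.le_siteCriticalProb_of_checkSK` (`…PcintWinKernelCert`).  No external certificate, no
`native_decide`; axioms standard.  (The lane's two-implementation certificates reach further at larger memory; this is the kernel-only row.)
-/

namespace Summit.CriticalPhenomena.PercolationContinuityZ3.Theorems.Pcint

open Literature.Probability.Percolation Literature.Probability.LatticeModels Z6S5

/-- All `20736` coded Collatz–Wielandt rows check. [folklore] -/
theorem Z6S5.chkAll : WinK.allRange (WinK.nfOKS 6 3 1001 9905 99999 tbl 81362) 0 20736 = true :=
  chkFile_1

/-- **`p_c^site(ℤ⁶) ≥ 0.1001`** (kernel-checked B2r window certificate, memory 5 (4-step windows, 20736 codes); the tree's previous kernel bound is the memory-4 closed form `1/((d-1)+√((d-1)²+1)) = 0.0990`; printed lower bound = the bond one). [folklore] -/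
theorem siteCriticalProb_Z6_ge_01001 : (0.1001 : ℝ) ≤ siteCriticalProb (zdGraph 6) 0 := by
  have h := WinK.le_siteCriticalProb_of_checkSK (d := 6) (m := 3) (pn := 1001) (Q := 9905) (lamN := 99999)
      (tbl := tbl) (dflt := 81362) (vlo := 81362) (vhi := 100000) (by norm_num) (by norm_num) (by norm_num) (by norm_num)
      (by norm_num) tbl_bounds (by norm_num) (by norm_num) chkAll
  have e : ((1001 : ℕ) : ℝ) / 10 ^ 4 = 0.1001 := by norm_num
  rw [e] at h
  exact h

end Summit.CriticalPhenomena.PercolationContinuityZ3.Theorems.Pcint
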